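import Summits.BirchSwinnertonDyer.BirchSwinnertonDyer.Theorems.OneSidedTwistSqueezeX9KatoDivisibilityX9StubReciprocityPkX9Transfer
import Summits.BirchSwinnertonDyer.BirchSwinnertonDyer.Theorems.SmallImageMuTransferMuTransferX9KolyvaginValueDivision
import Mathlib.Algebra.CharP.Lemmas
import HarnessLib

set_option autoImplicit false

-- the summit and its single problem are both named `BirchSwinnertonDyer` (registry layout D-0017)
set_option linter.dupNamespace false

/-!
# Crux `KatoDivisibilityX9` (stmt-BirchSwinnertonDyer-20547), line `graded_euler_loss`, stub
# `stub_reciprocityPkAX9` (hG34ᵍ), item (M2) of `hKolyRecPk`, file 2: THE DIVISION STEP AT LEVEL `p^{k+1}` —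
# dividing the key relation `(φ̃ − 1)·a' = −(φ̃ − 1)²·t` by `φ̃ − 1 = ω·Q(S)`, `ω = (1+S)^{p^N} − 1` NOT a monomial,
# through the `ω`-adic filtration of `(ℤ/p^{k+1})[T]/(T^{L'})`: `T^L = m·ω² (mod p^{k+1})` for `L = 2p^N(k+1)`

Seat `bsd-line-k6-p4` (prover-bsd-line-k6-p4-g5-0, wave-2 stub worker B).  THEOREMS ONLY (no definition, no named
fact, no `sorry`); pure algebra on the coordinate model `Fin L' → M` of `M ⊗ ℤ[T]/(T^{L'})` (`T` = the shift `S`) for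
an abelian group `M` killed by `n = p^{k+1}`; `--supports stmt-BirchSwinnertonDyer-20547 --as helper`.
Level-`p^{k+1}` replacement of k6-g3's `…X9KolyvaginValueDivision` (`(1+S)^{p^m u} − 1 = S^{p^m}·unit` modulo `p`,
`neg_castLE_eq_shiftEnd_pow_aeval_castLE`), where at level `p^{k+1}` (`k ≥ 1`) the operator `φ̃ − 1` is
`ω(S)·Q(S)` with `ω = (X+1)^{p^N} − 1` monic but NOT a unit multiple of a power of `S`.  MEMO-es §15 STEP 3:
`ker(ω·)` is controlled by the identity `X^L = m·ω² + p^{k+1}·h` in `ℤ[X]` (`L = 2p^N(k+1)`; the tree's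
`GradedCoreAlgebra.pow_mem_span_prime_pow_omega_sq`): `ω(S)·y = 0 ⟹ S^L·y = 0`, so `y` is supported in degrees
`≥ L' − L`, and every polynomial in `S` applied to `y` dies modulo `T^L` as soon as `L' ≥ 2L`.

* §1 (`ℤ[X]`): `exists_omega_sq_rel` (`m·ω² + p^{k+1}·h = X^L`), `map_omega_eq_X_pow` (`ω ≡ X^{p^N} (mod p)`),
  `map_mul_omega_eq_X_pow` (`m·ω ≡ X^{L − p^N} (mod p)`), `geom_sum_spec` (`ω·Q = (X+1)^{p^N u} − 1`,
  `Q = Σ_{j<u} (X+1)^{p^N j}`, `Q(0) = u`), `dvd_coeff_of_map_sub_eq_zero`.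
* §2 (operators on `Fin L' → M`, `n • M = 0`): `aeval_shiftEnd_X_pow_eq` (`S^L = (m ω²)(S)`),
  `shiftEnd_pow_apply_eq_zero_of_aeval_omega_apply_eq_zero` (`ω(S) y = 0 ⟹ S^L y = 0`),
  `castLE_aeval_apply_eq_zero_of_shiftEnd_pow_apply_eq_zero` (`S^L y = 0`, `2L ≤ L'` ⟹ `F(S) y ≡ 0 (mod T^L)`),
  `castLE_aeval_sub_one_sq_apply_eq_zero` (the projection `π = (m·Q)(S)·(· mod T^L)` KILLS `(φ̃ − 1)²·w`), and
  **`castLE_aeval_eq_neg_aeval_castLE_of_key_relation`** (THE DIVISION: from `(φ̃−1)a = −(φ̃−1)²t` at level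
  `L' ≥ 2L`, `π a = −V(S)·(t mod T^L)` with `V = m·ω·Q²`).
* §3 the VALUE POLYNOMIAL `V = m·ω·Q²`: `prime_pow_dvd_coeff_valuePoly_mul_omega` (`p^{k+1} ∣ (V·ω)_i`, `i < L`),
  `prime_dvd_coeff_valuePoly_sub` (`V ≡ Q²·X^{L − p^N} (mod p)`), `not_prime_dvd_coeff_zero_sq` (`p ∤ (Q²)(0)`) — the
  three polynomial clauses of `hKolyRecPk`.

References: L. Washington, GTM 83, §7.1–7.2 (`Λ/(p^k, f)`, distinguished polynomials), §13.1–13.2 [Washington1997];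
B. Mazur, K. Rubin, Mem. AMS 799 (2004) §5.3 [MazurRubin2004]; B. Perrin-Riou, Ann. Inst. Fourier 48 (1998) Prop. 3.1.6;
HOME/MEMO-es.md §15 STEP 3.
-/

noncomputable section

open Polynomial Finset
open Literature.NumberTheory.GaloisRepresentations
open Literature.NumberTheory.EllipticCurves
open Summit.BirchSwinnertonDyer.BirchSwinnertonDyer.Rank1Residual
open Summit.BirchSwinnertonDyer.BirchSwinnertonDyer.Theorems.OneSidedTwistSqueezeX9KatoDivisibilityX9StubReciprocityPkX9Transfer
open Summit.BirchSwinnertonDyer.BirchSwinnertonDyer.Theorems.OneSidedTwistSqueezeX9KatoDivisibilityX9GradedCoreAlgebra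

namespace Summit.BirchSwinnertonDyer.BirchSwinnertonDyer.Theorems.OneSidedTwistSqueezeX9KatoDivisibilityX9KolyvaginReciprocityPkDivision

/-! ## §1 Identities in `ℤ[X]` and `𝔽_p[X]` -/

section Ring

/-- **`X^{2p^N(k+1)} = m·ω² + p^{k+1}·h` in `ℤ[X]`**, `ω = (X+1)^{p^N} − 1` (the tree's
`pow_mem_span_prime_pow_omega_sq` in the ring `ℤ[X]`, unpacked with `Ideal.mem_span_pair`).
[cite: Washington1997, §7.1–§7.2] -/
theorem exists_omega_sq_rel {p : ℕ} (hp : p.Prime) (N k : ℕ) :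
    ∃ m h : ℤ[X], m * ((X + 1 : ℤ[X]) ^ p ^ N - 1) ^ 2 + (p : ℤ[X]) ^ (k + 1) * h =
      X ^ (2 * p ^ N * (k + 1)) := by
  have hmem := pow_mem_span_prime_pow_omega_sq (R := ℤ[X]) hp X N k
  rw [Ideal.mem_span_pair] at hmem
  obtain ⟨a, b, hab⟩ := hmem
  refine ⟨b, a, ?_⟩
  rw [add_comm (X : ℤ[X]) 1, ← hab]
  ring

/-- `ω = (X+1)^{p^N} − 1 ≡ X^{p^N} (mod p)` (freshman's dream in `𝔽_p[X]`). [cite: Washington1997, §7.2] -/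
theorem map_omega_eq_X_pow (p : ℕ) [Fact p.Prime] (N : ℕ) :
    ((X + 1 : ℤ[X]) ^ p ^ N - 1).map (Int.castRingHom (ZMod p)) = X ^ p ^ N := by
  rw [Polynomial.map_sub, Polynomial.map_pow, Polynomial.map_add, Polynomial.map_X, Polynomial.map_one,
    add_pow_char_pow, one_pow, add_sub_cancel_right]

/-- **`m·ω ≡ X^{L − p^N} (mod p)`** when `m·ω² + p^{k+1}·h = X^L`, `L = 2p^N(k+1)`: reduce modulo `p`
(`ω ≡ X^{p^N}`) and cancel `X^{2p^N}` in the domain `𝔽_p[X]`. [cite: Washington1997, §7.2] -/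
theorem map_mul_omega_eq_X_pow (p : ℕ) [Fact p.Prime] (N k : ℕ) {m h : ℤ[X]}
    (hrel : m * ((X + 1 : ℤ[X]) ^ p ^ N - 1) ^ 2 + (p : ℤ[X]) ^ (k + 1) * h = X ^ (2 * p ^ N * (k + 1))) :
    (m * ((X + 1 : ℤ[X]) ^ p ^ N - 1)).map (Int.castRingHom (ZMod p)) = X ^ (2 * p ^ N * (k + 1) - p ^ N) := by
  have hp0 : ((p : ℤ[X]) ^ (k + 1) * h).map (Int.castRingHom (ZMod p)) = 0 := by
    rw [Polynomial.map_mul, Polynomial.map_pow, Polynomial.map_natCast, CharP.cast_eq_zero, zero_pow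
      (Nat.succ_ne_zero k), zero_mul]
  have h1 := congrArg (Polynomial.map (Int.castRingHom (ZMod p))) hrel
  rw [Polynomial.map_add, hp0, add_zero, Polynomial.map_mul, Polynomial.map_pow, map_omega_eq_X_pow,
    Polynomial.map_pow, Polynomial.map_X] at h1
  -- `m̄ · X^{2e} = X^{2e(k+1)} = X^{2e(k+1) − 2e} · X^{2e}`
  have he : 2 * p ^ N ≤ 2 * p ^ N * (k + 1) := Nat.le_mul_of_pos_right _ (Nat.succ_pos k)
  have h2 : m.map (Int.castRingHom (ZMod p)) * X ^ (2 * p ^ N) =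
      X ^ (2 * p ^ N * (k + 1) - 2 * p ^ N) * X ^ (2 * p ^ N) := by
    rw [← pow_add, Nat.sub_add_cancel he, ← h1, ← pow_mul, mul_comm (p ^ N) 2]
  have hm : m.map (Int.castRingHom (ZMod p)) = X ^ (2 * p ^ N * (k + 1) - 2 * p ^ N) :=
    mul_right_cancel₀ (pow_ne_zero _ X_ne_zero) h2
  rw [Polynomial.map_mul, hm, map_omega_eq_X_pow, ← pow_add]
  congr 1
  have : p ^ N ≤ 2 * p ^ N := by omega
  omega

/-- **The geometric-sum cofactor**: `ω · Q = (X+1)^{p^N u} − 1` for `Q = Σ_{j<u} ((X+1)^{p^N})^j`, and `Q(0) = u`.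
[cite: Washington1997, §13.1–§13.2] -/
theorem omega_mul_geom_sum (e u : ℕ) :
    ((X + 1 : ℤ[X]) ^ e - 1) * (∑ j ∈ range u, ((X + 1 : ℤ[X]) ^ e) ^ j) = (X + 1 : ℤ[X]) ^ (e * u) - 1 ∧
      (∑ j ∈ range u, ((X + 1 : ℤ[X]) ^ e) ^ j).coeff 0 = (u : ℤ) := by
  refine ⟨?_, ?_⟩
  · rw [mul_comm, geom_sum_mul, pow_mul]
  · rw [coeff_zero_eq_eval_zero, eval_finsetSum]
    simp [eval_pow]

/-- Coefficientwise congruence from an identity modulo `n`: if `F ≡ G` in `(ℤ/n)[X]` then `n ∣ (F − G)_i` for all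
`i`. [folklore] -/
theorem dvd_coeff_sub_of_map_eq {n : ℕ} [NeZero n] {F G : ℤ[X]}
    (h : F.map (Int.castRingHom (ZMod n)) = G.map (Int.castRingHom (ZMod n))) (i : ℕ) :
    (n : ℤ) ∣ (F - G).coeff i := by
  have hi := congrArg (fun P : (ZMod n)[X] => P.coeff i) h
  simp only [coeff_map, Int.coe_castRingHom] at hi
  rw [coeff_sub, ← ZMod.intCast_zmod_eq_zero_iff_dvd, Int.cast_sub, hi, sub_self]

end Ring

/-! ## §2 Operators on `Fin L' → M`, `n • M = 0`: the `ω`-adic division -/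

section Operator

variable {M : Type*} [AddCommGroup M] {n : ℕ} (hM : ∀ x : M, n • x = 0) {L L' : ℕ} {m ω h : ℤ[X]}
  (hrel : m * ω ^ 2 + (n : ℤ[X]) * h = X ^ L)

include hM hrel in
/-- **`S^L = (m·ω²)(S)` on `Fin L' → M`** when `m·ω² + n·h = X^L` and `n • M = 0`. [cite: Washington1997, §7.1–§7.2] -/
theorem aeval_shiftEnd_X_pow_eq : shiftEnd M L' ^ L = aeval (shiftEnd M L') (m * ω ^ 2) := by
  have h0 : aeval (shiftEnd M L') ((n : ℤ[X]) * h) = 0 :=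
    aeval_shiftEnd_eq_zero_of_forall_dvd_coeff (J := L') hM _ fun i _ => by
      rw [← C_eq_natCast, coeff_C_mul]; exact dvd_mul_right _ _
  have := congrArg (aeval (shiftEnd M L')) hrel
  rw [map_add, h0, add_zero, map_pow, aeval_X] at this
  exact this.symm

include hM hrel in
/-- **`ω(S) y = 0 ⟹ S^L y = 0`**: `S^L = (mω)(S) ∘ ω(S)` on `n`-torsion coefficients (`ker(ω·) ⊆ ker(T^L·)` in
`M ⊗ ℤ[T]/(n, T^{L'})`). [cite: Washington1997, §7.1–§7.2] -/
theorem shiftEnd_pow_apply_eq_zero_of_aeval_omega_apply_eq_zero (y : Fin L' → M)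
    (hy : aeval (shiftEnd M L') ω y = 0) : (shiftEnd M L' ^ L) y = 0 := by
  rw [aeval_shiftEnd_X_pow_eq hM hrel, sq, ← mul_assoc, map_mul, Module.End.mul_apply, hy, map_zero]

omit hM in
/-- **A vector killed by `S^L` dies modulo `T^L` under every polynomial in `S`, once `2L ≤ L'`**: `S^L y = 0` means `y` is
supported in degrees `≥ L' − L ≥ L`, and `F(S)` does not lower degrees. [cite: Washington1997, §13.1–§13.2] -/
theorem castLE_aeval_apply_eq_zero_of_shiftEnd_pow_apply_eq_zero (h2 : L + L ≤ L') (y : Fin L' → M)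
    (hy : (shiftEnd M L' ^ L) y = 0) (F : ℤ[X]) :
    (fun i : Fin L => aeval (shiftEnd M L') F y (Fin.castLE (by omega) i)) = 0 := by
  refine KolyvaginTwist.castLE_eq_zero_of_shiftEnd_pow_apply_eq_zero h2 _ ?_
  rw [← Module.End.mul_apply, ((LocalSplitPrime.commute_aeval_self (shiftEnd M L') F).pow_left L).eq,
    Module.End.mul_apply, hy, map_zero]

include hM hrel in
/-- **The projection `π = (m·Q)(S) ∘ (· mod T^L)` kills `(φ̃ − 1)²·w`** for `φ̃ − 1 = (ω·Q)(S)`: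
`m Q ω² Q² = Q³·(X^L − n h)`, and `S^L w ≡ 0 (mod T^L)`. [cite: Washington1997, §7.1–§7.2] -/
theorem castLE_aeval_sub_one_sq_apply_eq_zero (hLL' : L ≤ L') (Q : ℤ[X]) (w : Fin L' → M) :
    (fun i : Fin L => aeval (shiftEnd M L') (m * Q)
      (aeval (shiftEnd M L') (ω * Q) (aeval (shiftEnd M L') (ω * Q) w)) (Fin.castLE hLL' i)) = 0 := by
  have hcomp : aeval (shiftEnd M L') (m * Q) (aeval (shiftEnd M L') (ω * Q) (aeval (shiftEnd M L') (ω * Q) w)) =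
      aeval (shiftEnd M L') (Q ^ 3) ((shiftEnd M L' ^ L) w) := by
    rw [← Module.End.mul_apply, ← Module.End.mul_apply, ← map_mul, ← map_mul, aeval_shiftEnd_X_pow_eq hM hrel,
      ← Module.End.mul_apply, ← map_mul]
    congr 2
    ring
  rw [hcomp, KolyvaginTwist.castLE_aeval_shiftEnd_apply hLL' (Q ^ 3), KolyvaginTwist.castLE_shiftEnd_pow_apply hLL' L,
    shiftEnd_pow_eq_zero le_rfl, LinearMap.zero_apply, map_zero]

include hM hrel in
/-- **THE DIVISION STEP AT LEVEL `p^{k+1}`** (MEMO-es §15 STEP 3; MU-TRANSFER-PROOF §3 "`(φ̃ − 1)t_N = −P·t_1 ⟹ t_N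
= −V(S) t_1`").  On `Fin L' → M` (`n • M = 0`, `m·ω² + n·h = X^L`, `2L ≤ L'`), let `φ̃ − 1 = (ω·Q)(S)` (`φ̃ = (1+S)^{p^N u}`,
`ω·Q = (X+1)^{p^N u} − 1`).  If `(φ̃ − 1) a = −(φ̃ − 1)((φ̃ − 1) t)` (the key relation of the Kolyvagin cocycle), then
the projection `π a := (m·Q)(S) a mod T^L` equals `−V(S)·(t mod T^L)` with the VALUE POLYNOMIAL `V = m·ω·Q²`:
`ω(S)·Q(S)(a + (φ̃−1)t) = 0 ⟹ S^L·Q(S)(a + (φ̃−1)t) = 0 ⟹ (mQ)(S)(a + (φ̃−1)t) ≡ 0 (mod T^L)`.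
[cite: Washington1997, §7.1–§7.2 and §13.2] [cite: MazurRubin2004, §5.3] -/
theorem castLE_aeval_eq_neg_aeval_castLE_of_key_relation (h2 : L + L ≤ L') (Q : ℤ[X]) (a t : Fin L' → M)
    (hkey : aeval (shiftEnd M L') (ω * Q) a =
      -(aeval (shiftEnd M L') (ω * Q) (aeval (shiftEnd M L') (ω * Q) t))) :
    (fun i : Fin L => aeval (shiftEnd M L') (m * Q) a (Fin.castLE (by omega) i)) =
      -(aeval (shiftEnd M L) (m * ω * Q ^ 2) fun i => t (Fin.castLE (by omega) i)) := by
  -- `ω(S) (Q(S) z) = 0` for `z = a + (φ̃−1) t`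
  set z : Fin L' → M := a + aeval (shiftEnd M L') (ω * Q) t with hz
  have hωz : aeval (shiftEnd M L') ω (aeval (shiftEnd M L') Q z) = 0 := by
    rw [← Module.End.mul_apply, ← map_mul, hz, map_add, hkey, neg_add_cancel]
  have hSz := shiftEnd_pow_apply_eq_zero_of_aeval_omega_apply_eq_zero hM hrel _ hωz
  have hmz := castLE_aeval_apply_eq_zero_of_shiftEnd_pow_apply_eq_zero h2 _ hSz m
  -- `(mQ)(S) a = (mQ)(S) z − (m ω Q²)(S) t`
  have hsplit : aeval (shiftEnd M L') (m * Q) a =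
      aeval (shiftEnd M L') m (aeval (shiftEnd M L') Q z) - aeval (shiftEnd M L') (m * ω * Q ^ 2) t := by
    rw [← Module.End.mul_apply, ← map_mul, hz, map_add, ← Module.End.mul_apply, ← map_mul, add_sub_assoc,
      show m * Q * (ω * Q) = m * ω * Q ^ 2 by ring, sub_self, add_zero]
  have hLL' : L ≤ L' := by omega
  funext i
  have hi := congrFun hmz i
  simp only [Pi.zero_apply] at hi
  rw [hsplit, Pi.sub_apply, hi, zero_sub, Pi.neg_apply,
    ← aeval_shiftEnd_comp_castLE hLL' (m * ω * Q ^ 2) t]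

end Operator

/-! ## §3 The value polynomial `V = m·ω·Q²` -/

section ValuePoly

variable (p : ℕ) [Fact p.Prime] (N k u : ℕ)

/-- `p ∤ (Q²)(0) = u²` for `Q = Σ_{j<u} ((X+1)^{p^N})^j` and `p ∤ u`. [cite: Washington1997, §13.2] -/
theorem not_prime_dvd_coeff_zero_geom_sum_sq (hu : ¬ p ∣ u) :
    ¬ ((p : ℤ) ∣ ((∑ j ∈ range u, ((X + 1 : ℤ[X]) ^ p ^ N) ^ j) ^ 2).coeff 0) := by
  rw [coeff_zero_eq_eval_zero, eval_pow, ← coeff_zero_eq_eval_zero, (omega_mul_geom_sum (p ^ N) u).2,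
    ← Nat.cast_pow, Int.natCast_dvd_natCast]
  intro h
  exact hu ((Fact.out : p.Prime).dvd_of_dvd_pow h)

variable {p N k}

omit [Fact p.Prime] in
/-- **`p^{k+1} ∣ (V·ω)_i` for `i < L`**, `V = m·ω·Q²`: `V·ω = Q²·(X^L − p^{k+1} h)`.  The `ω_N`-annihilation clause of
`hKolyRecPk` (with it `V(S)` kills every `(γ^t − 1)`-coboundary of depth `≥ N`, `…Transfer.aeval_shiftEnd_unipotentPow_sub_eq_zero`).
[cite: Washington1997, §7.1–§7.2] [cite: MazurRubin2004, §5.3] -/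
theorem prime_pow_dvd_coeff_valuePoly_mul_omega {m h : ℤ[X]}
    (hrel : m * ((X + 1 : ℤ[X]) ^ p ^ N - 1) ^ 2 + (p : ℤ[X]) ^ (k + 1) * h = X ^ (2 * p ^ N * (k + 1)))
    (Q : ℤ[X]) (i : ℕ) (hi : i < 2 * p ^ N * (k + 1)) :
    (p : ℤ) ^ (k + 1) ∣ (m * ((X + 1 : ℤ[X]) ^ p ^ N - 1) * Q ^ 2 * ((X + 1 : ℤ[X]) ^ p ^ N - 1)).coeff i := by
  have hVω : m * ((X + 1 : ℤ[X]) ^ p ^ N - 1) * Q ^ 2 * ((X + 1 : ℤ[X]) ^ p ^ N - 1) =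
      X ^ (2 * p ^ N * (k + 1)) * Q ^ 2 - C ((p : ℤ) ^ (k + 1)) * (h * Q ^ 2) := by
    rw [← hrel, C_pow, C_eq_natCast]
    ring
  rw [hVω, coeff_sub, coeff_X_pow_mul', if_neg (not_le.mpr hi), zero_sub, coeff_C_mul, dvd_neg]
  exact dvd_mul_right _ _

/-- **`V ≡ Q²·X^{L − p^N} (mod p)` coefficientwise**, `V = m·ω·Q²` (`m·ω ≡ X^{L−p^N} (mod p)`): the clause
"`V ≡ U·X^{J+1−(e'+1)} (mod p)`" of `hKolyRecPk` with `U = Q²`, `p ∤ U(0)`. [cite: Washington1997, §7.2 and §13.2] -/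
theorem prime_dvd_coeff_valuePoly_sub {m h : ℤ[X]}
    (hrel : m * ((X + 1 : ℤ[X]) ^ p ^ N - 1) ^ 2 + (p : ℤ[X]) ^ (k + 1) * h = X ^ (2 * p ^ N * (k + 1)))
    (Q : ℤ[X]) (i : ℕ) :
    (p : ℤ) ∣ (m * ((X + 1 : ℤ[X]) ^ p ^ N - 1) * Q ^ 2 - Q ^ 2 * X ^ (2 * p ^ N * (k + 1) - p ^ N)).coeff i := by
  refine dvd_coeff_sub_of_map_eq (n := p) ?_ i
  rw [Polynomial.map_mul, map_mul_omega_eq_X_pow p N k hrel, Polynomial.map_mul, Polynomial.map_pow,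
    Polynomial.map_pow, Polynomial.map_X, mul_comm]

end ValuePoly

end Summit.BirchSwinnertonDyer.BirchSwinnertonDyer.Theorems.OneSidedTwistSqueezeX9KatoDivisibilityX9KolyvaginReciprocityPkDivision

end
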